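import Summits.AtomisticToContinuum.BoseEinsteinCondensation.Theorems.BECRewardDescentCondensedTrialState
import Literature.MathematicalPhysics.QuantumManyBody.BoseGasCutoffState
import Literature.MathematicalPhysics.QuantumManyBody.BoseGasCutoffStateEnergy
import Literature.MathematicalPhysics.QuantumManyBody.BoseGasCutoffStateOccupation
import Literature.MathematicalPhysics.QuantumManyBody.BoseGasMergeOccupation
import Literature.MathematicalPhysics.QuantumManyBody.NeumannMomentumCutoffs
import Literature.MathematicalPhysics.QuantumManyBody.BoseGasCatStates

/-!
# Route `BECNudgeWalk`, crux `NudgedCondensation` (stmt-AtomisticToContinuum-14362),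
# line `registered` (skeleton `Lines/birth.lean`) — stub `stub_condensedTrial`

The load-bearing stub of the skeleton: **a condensed Dirichlet trial state**. For every repulsive
finite-range pair potential `v` with scattering length `a = (scatteringLength v).toReal > 0` and
every `η > 0` there is `ρ₀ > 0` such that for `0 < ρ < ρ₀` and all large `N`, in the Dirichlet box of
side `L = (N/ρ)^{1/3}` some admissible (`C¹`, Bose-symmetric, Dirichlet, normalised) trial state
`Ψ` has energy `⟨Ψ, HΨ⟩ ≤ 4πρa(1+η)N` AND flat-mode occupation `⟨φ₀, γ_Ψ φ₀⟩ ≥ (1-η)N`,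
`φ₀ = constantMode L = L^{-3/2} 1_{[0,L)³}`.

## The construction

All analysis is in the tree; this file is bookkeeping.

* **Periodic input.** `Theorems.condensedTrialState_proof` (route `BECRewardDescent`, item
  stmt-AtomisticToContinuum-12879; the Jastrow product of the Dyson profile, LSSY 2005 Thm. 2.2):
  at tolerance `t/8`, `t = min η 1`, and at the slightly LARGER density `ρ' = ρ λ³`,
  `λ = 1 + 2κ`, `κ = (t/2560)²`, for all large `N` a periodic trial state `Φ` on the torus of side
  `L' = (N/ρ')^{1/3} = L/λ` has `⟨Φ,HΦ⟩_per ≤ 4πaρ'(1+t/8)N` and `n₀(Φ) ≥ (1-t/8)N`.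
* **Cut-off.** The Basti–Cenatiempo–Schlein state `cutoffTrialState` (App. A, Lemma A.1 of
  [BastiCenatiempoSchlein2021]) at shift `0` with ramps of width `2ℓ`, `ℓ = κL'`, is a Dirichlet
  trial state of the box of side `L' + 2ℓ = λL' = L` (`sideLength_div_pow_three`,
  `TrialState.castLen`).
* **Energy** (`energyIntegral_cutoffState_le_single_shift`, Young parameter
  `η₁ = t/(8(C+1))`): `⟨Ψ,HΨ⟩ ≤ (1 + Cη₁)⟨Φ,HΦ⟩_per + C(1+η₁⁻¹)(c/ℓ)²N`; since `ℓ → ∞` with `N`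
  the additive term is eventually `≤ 2πaρtN`, and `(1+t/8)³ ≤ 1 + t/2`
  (`condensedTrial_energy_budget`).
* **Occupation** (`condensateOccupation_le_occupation_cutoffState`):
  `n₀(Φ) ≤ λ³ n_{φ}(Ψ) + 320N√κ = λ³ n_φ(Ψ) + tN/8` for the flat mode `φ = boxConstantMode L` of the
  box, which agrees a.e. with `constantMode L` (`NeumannBox.box_ae_eq_cell`, `occupation_congr_ae`);
  hence `n_φ(Ψ) ≥ (1 - t/4)N/λ³ ≥ (1-t)N ≥ (1-η)N` (`condensedTrial_occupation_budget`).

References: LSSY 2005 (arXiv:cond-mat/0610117) Thm. 2.2; Basti–Cenatiempo–Schlein 2021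
(arXiv:2101.06222) App. A, Lemma A.1; Fournais 2020 (1.3)–(1.5).
-/

noncomputable section

namespace Summit.AtomisticToContinuum.BoseEinsteinCondensation.NudgedCondensationLine

open MeasureTheory Filter
open scoped ENNReal NNReal
open Literature.MathematicalPhysics.QuantumManyBody.BoseGas

/-! ### Real-arithmetic bookkeeping -/

/-- `(1 + 2κ)³ ≤ 1 + t/8` for `κ = (t/2560)²`, `0 ≤ t ≤ 1`. [folklore] -/
theorem condensedTrial_lam_pow_three_le {t : ℝ} (ht0 : 0 ≤ t) (ht1 : t ≤ 1) :
    (1 + 2 * (t / 2560) ^ 2) ^ 3 ≤ 1 + t / 8 := by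
  set κ : ℝ := (t / 2560) ^ 2 with hκ
  have hκ0 : 0 ≤ κ := by positivity
  have hκt : κ ≤ t / 6553600 := by
    rw [hκ]
    nlinarith [mul_nonneg ht0 (sub_nonneg.2 ht1)]
  have hκ1 : κ ≤ 1 := by linarith
  calc (1 + 2 * κ) ^ 3 = 1 + 6 * κ + 12 * κ ^ 2 + 8 * κ ^ 3 := by ring
    _ ≤ 1 + 6 * κ + 12 * κ + 8 * κ := by
        nlinarith [mul_nonneg hκ0 (sub_nonneg.2 hκ1),
          mul_nonneg (mul_nonneg hκ0 hκ0) (sub_nonneg.2 hκ1)]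
    _ = 1 + 26 * κ := by ring
    _ ≤ 1 + t / 8 := by linarith

/-- **Energy budget** of the cut-off state: with `Cη₁ ≤ t/8`, `λ³ ≤ 1 + t/8`, periodic tolerance
`t/8` and ramp error `C(1+η₁⁻¹)c² ≤ 2πaρtℓ²`,
`(1 + Cη₁)·4πa(ρλ³)(1+t/8)N + C(1+η₁⁻¹)(c/ℓ)²N ≤ 4πρa(1+η)N` (`t ≤ min(η,1)`). [folklore] -/
theorem condensedTrial_energy_budget {C η₁ c ℓ a ρ t η lam3 N : ℝ}
    (ha : 0 ≤ a) (hρ : 0 ≤ ρ) (hN : 0 ≤ N) (ht0 : 0 ≤ t) (ht1 : t ≤ 1) (htη : t ≤ η)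
    (hCη : C * η₁ ≤ t / 8) (hlam0 : 0 ≤ lam3) (hlam : lam3 ≤ 1 + t / 8) (hℓ : 0 < ℓ)
    (hKℓ : C * (1 + η₁⁻¹) * c ^ 2 ≤ 2 * Real.pi * a * ρ * t * ℓ ^ 2) :
    (1 + C * η₁) * (4 * Real.pi * a * (ρ * lam3) * (1 + t / 8) * N) +
        C * (1 + η₁⁻¹) * (c / ℓ) ^ 2 * N ≤
      4 * Real.pi * ρ * a * (1 + η) * N := by
  set P : ℝ := 4 * Real.pi * a * ρ * N with hP
  have hP0 : 0 ≤ P := by positivity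
  have h1 : (1 + C * η₁) * (4 * Real.pi * a * (ρ * lam3) * (1 + t / 8) * N) =
      ((1 + C * η₁) * lam3 * (1 + t / 8)) * P := by
    rw [hP]; ring
  have hA : 1 + C * η₁ ≤ 1 + t / 8 := by linarith
  have hB : 0 ≤ 1 + t / 8 := by linarith
  have h2 : (1 + C * η₁) * lam3 * (1 + t / 8) ≤ (1 + t / 8) * ((1 + t / 8) * (1 + t / 8)) :=
    calc (1 + C * η₁) * lam3 * (1 + t / 8) = (1 + C * η₁) * (lam3 * (1 + t / 8)) := by ring
      _ ≤ (1 + t / 8) * (lam3 * (1 + t / 8)) :=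
          mul_le_mul_of_nonneg_right hA (mul_nonneg hlam0 hB)
      _ ≤ (1 + t / 8) * ((1 + t / 8) * (1 + t / 8)) :=
          mul_le_mul_of_nonneg_left (mul_le_mul_of_nonneg_right hlam hB) hB
  have h3 : (1 + t / 8) * ((1 + t / 8) * (1 + t / 8)) ≤ 1 + t / 2 := by
    nlinarith [mul_nonneg ht0 (sub_nonneg.2 ht1), mul_nonneg (sq_nonneg t) (sub_nonneg.2 ht1)]
  have h4 : C * (1 + η₁⁻¹) * (c / ℓ) ^ 2 * N ≤ 2 * Real.pi * a * ρ * t * N := by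
    refine mul_le_mul_of_nonneg_right ?_ hN
    rw [div_pow, ← mul_div_assoc, div_le_iff₀ (pow_pos hℓ 2)]
    exact hKℓ
  calc (1 + C * η₁) * (4 * Real.pi * a * (ρ * lam3) * (1 + t / 8) * N) +
        C * (1 + η₁⁻¹) * (c / ℓ) ^ 2 * N
      = ((1 + C * η₁) * lam3 * (1 + t / 8)) * P + C * (1 + η₁⁻¹) * (c / ℓ) ^ 2 * N := by rw [h1]
    _ ≤ (1 + t / 2) * P + 2 * Real.pi * a * ρ * t * N :=
        add_le_add (mul_le_mul_of_nonneg_right (h2.trans h3) hP0) h4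
    _ = (1 + t) * P := by rw [hP]; ring
    _ ≤ (1 + η) * P := mul_le_mul_of_nonneg_right (by linarith) hP0
    _ = 4 * Real.pi * ρ * a * (1 + η) * N := by rw [hP]; ring

/-- **Occupation budget** of the cut-off state: with `1 ≤ λ³ ≤ 1 + t/8`, `t ≤ min(η,1)`,
`λ³(1-η)N ≤ (1 - t/8)N - 320N·(t/2560) = (1 - t/4)N`. [folklore] -/
theorem condensedTrial_occupation_budget {t η lam3 N : ℝ} (ht0 : 0 ≤ t) (ht1 : t ≤ 1)
    (htη : t ≤ η) (hlam1 : 1 ≤ lam3) (hlam : lam3 ≤ 1 + t / 8) (hN : 0 ≤ N) :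
    lam3 * ((1 - η) * N) ≤ (1 - t / 8) * N - 320 * N * (t / 2560) := by
  have hR : (1 - t / 8) * N - 320 * N * (t / 2560) = (1 - t / 4) * N := by ring
  rw [hR]
  rcases le_or_gt η 1 with hη1 | hη1
  · have h1 : lam3 * (1 - η) ≤ (1 + t / 8) * (1 - t) :=
      mul_le_mul hlam (by linarith) (by linarith) (by linarith)
    have h2 : (1 + t / 8) * (1 - t) ≤ 1 - t / 4 := by nlinarith [sq_nonneg t]
    calc lam3 * ((1 - η) * N) = (lam3 * (1 - η)) * N := by ring
      _ ≤ (1 - t / 4) * N := mul_le_mul_of_nonneg_right (h1.trans h2) hN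
  · have hA : (1 - η) * N ≤ 0 := mul_nonpos_iff.mpr (Or.inr ⟨by linarith, hN⟩)
    have h1 : lam3 * ((1 - η) * N) ≤ 0 := mul_nonpos_iff.mpr (Or.inl ⟨by linarith, hA⟩)
    have h2 : 0 ≤ (1 - t / 4) * N := mul_nonneg (by linarith) hN
    linarith

/-! ### The stub -/

/-- **Stub `stub_condensedTrial` of the skeleton `Lines/birth.lean` (crux `NudgedCondensation`,
stmt-AtomisticToContinuum-14362): the condensed Dirichlet trial state.** For repulsive finite-range
`v` with `a = (scatteringLength v).toReal > 0` and every `η > 0` there is `ρ₀ > 0` such that for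
`0 < ρ < ρ₀` and all large `N` some Dirichlet trial state `Ψ` in the box of side `(N/ρ)^{1/3}` has
`⟨Ψ,HΨ⟩ ≤ 4πρa(1+η)N` and `⟨φ₀, γ_Ψ φ₀⟩ ≥ (1-η)N` for `φ₀ = constantMode ((N/ρ)^{1/3})`.
The witness is the Basti–Cenatiempo–Schlein cut-off (shift `0`, ramps `ℓ = κL'`,
`κ = (min(η,1)/2560)²`) of the in-tree periodic condensed trial state
(`condensedTrialState_proof`) taken on the torus of side `L' = L/(1+2κ)`, i.e. at density
`ρ(1+2κ)³`; energy by `energyIntegral_cutoffState_le_single_shift`, occupation by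
`condensateOccupation_le_occupation_cutoffState` and `box =ᵐ cell`.
[cite: BastiCenatiempoSchlein2021, App. A, Lemma A.1] -/
theorem stub_condensedTrial :
    ∀ v : ℝ → ENNReal, IsRepulsiveFiniteRange v → 0 < (scatteringLength v).toReal →
      ∀ η : ℝ, 0 < η → ∃ ρ₀ : ℝ, 0 < ρ₀ ∧ ∀ ρ : ℝ, 0 < ρ → ρ < ρ₀ →
        ∀ᶠ N : ℕ in Filter.atTop,
          ∃ Ψ : TrialState N (sideLength ρ N),
            energy v Ψ ≤
                ENNReal.ofReal (4 * Real.pi * ρ * (scatteringLength v).toReal * (1 + η) * N) ∧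
              ENNReal.ofReal ((1 - η) * N) ≤
                occupation N (constantMode (sideLength ρ N)) Ψ.ψ := by
  intro v hv ha η hη
  have hvm : Measurable v := hv.1
  -- universal constants of the cut-off
  obtain ⟨C, hC0, hC⟩ := energyIntegral_cutoffState_le_single_shift
  obtain ⟨c, _hc0, hcq⟩ := exists_isCutoffProfile
  have hC1 : 0 < C + 1 := by linarith
  -- tolerances
  set t : ℝ := min η 1 with ht_def
  have ht0 : 0 < t := lt_min hη one_pos
  have ht1 : t ≤ 1 := min_le_right _ _
  have htη : t ≤ η := min_le_left _ _
  set η₁ : ℝ := t / (8 * (C + 1)) with hη₁_def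
  have hη₁ : 0 < η₁ := by positivity
  have hCη₁ : C * η₁ ≤ t / 8 := by
    calc C * η₁ ≤ (C + 1) * η₁ := by gcongr; linarith
      _ = t / 8 := by rw [hη₁_def]; field_simp
  set κ : ℝ := (t / 2560) ^ 2 with hκ_def
  have hκ0 : 0 < κ := by positivity
  have hκ1 : 2 * κ ≤ 1 := by
    rw [hκ_def]
    nlinarith [mul_le_mul ht1 ht1 ht0.le zero_le_one]
  set lam : ℝ := 1 + 2 * κ with hlam_def
  have hlam0 : 0 < lam := by linarith
  have hlam1 : 1 ≤ lam := by linarith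
  have hlam3 : lam ^ 3 ≤ 1 + t / 8 := by
    rw [hlam_def, hκ_def]
    exact condensedTrial_lam_pow_three_le ht0.le ht1
  have hlam31 : 1 ≤ lam ^ 3 := one_le_pow₀ hlam1
  -- the periodic condensed state at density `ρ·lam³` with tolerance `t/8`
  have hη' : 0 < t / 8 := by positivity
  obtain ⟨ρ₁, hρ₁, H⟩ := Theorems.condensedTrialState_proof v hv (t / 8) hη'
  refine ⟨ρ₁ / lam ^ 3, by positivity, fun ρ hρ hρlt => ?_⟩
  set ρ' : ℝ := ρ * lam ^ 3 with hρ'_def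
  have hρ' : 0 < ρ' := by positivity
  have hρ'lt : ρ' < ρ₁ := (lt_div_iff₀ (by positivity)).1 hρlt
  -- large-`N` requirements: the ramp `ℓ = κ L'` must exceed `B`
  set K : ℝ := C * (1 + η₁⁻¹) * c ^ 2 with hK_def
  have hK0 : 0 ≤ K := by positivity
  set B : ℝ := max 1 (K / (2 * Real.pi * (scatteringLength v).toReal * ρ * t)) with hB_def
  have hB1 : 1 ≤ B := le_max_left _ _
  filter_upwards [H ρ' hρ' hρ'lt, eventually_gt_atTop 0,
    (tendsto_sideLength_atTop hρ').eventually_ge_atTop (B / κ)] with N hΦ hN hbig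
  set L' : ℝ := sideLength ρ' N with hL'_def
  obtain ⟨Φ, hEΦ, hoccΦ⟩ := hΦ
  have hL' : 0 < L' := sideLength_pos_of_pos hρ' hN
  have hL'0 : L' ≠ 0 := hL'.ne'
  set ℓ : ℝ := κ * L' with hℓ_def
  have hℓ : 0 < ℓ := mul_pos hκ0 hL'
  have hℓL : 2 * ℓ ≤ L' := by
    calc 2 * ℓ = (2 * κ) * L' := by rw [hℓ_def]; ring
      _ ≤ 1 * L' := mul_le_mul_of_nonneg_right hκ1 hL'.le
      _ = L' := one_mul _
  have hℓB : B ≤ ℓ := by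
    rw [hℓ_def, mul_comm]
    exact (div_le_iff₀ hκ0).1 hbig
  -- side lengths: `L = lam · L' = L' + 2ℓ`
  have hLeq : L' + 2 * ℓ = sideLength ρ N := by
    have hρeq : ρ = ρ' / lam ^ 3 := by
      rw [hρ'_def, mul_div_assoc, div_self (pow_ne_zero 3 hlam0.ne'), mul_one]
    rw [hρeq,
      Literature.MathematicalPhysics.QuantumManyBody.JelliumBoseGas.sideLength_div_pow_three hρ' hlam0 N,
      hℓ_def, hL'_def, hlam_def]
    ring
  -- the cut-off profile and the Dirichlet state
  obtain ⟨q, hq⟩ := hcq ℓ L' hℓ hℓL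
  let Ψ₀ : TrialState N (L' + 2 * ℓ) := cutoffTrialState hL' hq Φ 0
  refine ⟨Ψ₀.castLen hLeq, ?_, ?_⟩
  · -- energy
    rw [TrialState.energy_castLen]
    have hE : energy v Ψ₀ ≤ (1 + ENNReal.ofReal (C * η₁)) * periodicEnergy v Φ +
        ENNReal.ofReal (C * (1 + η₁⁻¹) * (c / ℓ) ^ 2 * N) :=
      hC N ℓ L' (c / ℓ) q v η₁ 0 hℓ hℓL hvm hη₁ hq.contDiff hq.range hq.pu hq.deriv_le
        hq.deriv_support Φ
    have hKℓ : C * (1 + η₁⁻¹) * c ^ 2 ≤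
        2 * Real.pi * (scatteringLength v).toReal * ρ * t * ℓ ^ 2 := by
      have h1 : K / (2 * Real.pi * (scatteringLength v).toReal * ρ * t) ≤ ℓ :=
        (le_max_right _ _).trans hℓB
      have h2 : 1 ≤ ℓ := hB1.trans hℓB
      rw [div_le_iff₀ (by positivity)] at h1
      calc C * (1 + η₁⁻¹) * c ^ 2 = K := by rw [hK_def]
        _ ≤ ℓ * (2 * Real.pi * (scatteringLength v).toReal * ρ * t) := h1
        _ ≤ ℓ * (2 * Real.pi * (scatteringLength v).toReal * ρ * t) * ℓ :=
            le_mul_of_one_le_right (by positivity) h2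
        _ = 2 * Real.pi * (scatteringLength v).toReal * ρ * t * ℓ ^ 2 := by ring
    have hreal := condensedTrial_energy_budget (η := η) (N := (N : ℝ)) ha.le hρ.le
      (Nat.cast_nonneg N) ht0.le ht1 htη hCη₁ (by positivity : (0 : ℝ) ≤ lam ^ 3) hlam3 hℓ hKℓ
    rw [← hρ'_def] at hreal
    have e1 : (1 : ℝ≥0∞) + ENNReal.ofReal (C * η₁) = ENNReal.ofReal (1 + C * η₁) := by
      rw [ENNReal.ofReal_add zero_le_one (by positivity : (0 : ℝ) ≤ C * η₁), ENNReal.ofReal_one]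
    calc energy v Ψ₀ ≤ _ := hE
      _ ≤ (1 + ENNReal.ofReal (C * η₁)) *
            ENNReal.ofReal (4 * Real.pi * (scatteringLength v).toReal * ρ' * (1 + t / 8) * N) +
          ENNReal.ofReal (C * (1 + η₁⁻¹) * (c / ℓ) ^ 2 * N) := by gcongr
      _ = ENNReal.ofReal ((1 + C * η₁) *
            (4 * Real.pi * (scatteringLength v).toReal * ρ' * (1 + t / 8) * N) +
          C * (1 + η₁⁻¹) * (c / ℓ) ^ 2 * N) := by
          rw [e1, ← ENNReal.ofReal_mul (by positivity : (0 : ℝ) ≤ 1 + C * η₁),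
            ← ENNReal.ofReal_add
              (by positivity : (0 : ℝ) ≤ (1 + C * η₁) *
                (4 * Real.pi * (scatteringLength v).toReal * ρ' * (1 + t / 8) * N))
              (by positivity : (0 : ℝ) ≤ C * (1 + η₁⁻¹) * (c / ℓ) ^ 2 * N)]
      _ ≤ ENNReal.ofReal (4 * Real.pi * ρ * (scatteringLength v).toReal * (1 + η) * N) :=
          ENNReal.ofReal_le_ofReal hreal
  · -- occupation of the flat mode
    have hcut := condensateOccupation_le_occupation_cutoffState N hℓ hℓL hq.contDiff.continuous
      hq.range hq.support hq.pu Φ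
    set occB : ℝ≥0∞ := occupation N (boxConstantMode (L' + 2 * ℓ)) (fun X : Config N =>
      Φ.ψ (X + fun _ => (0 : Space)) * ((∏ p : Fin N × Fin 3, q (X p.1 p.2) : ℝ) : ℂ))
      with hoccB_def
    have hratio : (L' + 2 * ℓ) / L' = lam := by
      rw [hℓ_def, hlam_def, add_div, div_self hL'0, mul_div_assoc, mul_div_assoc, div_self hL'0,
        mul_one]
    have hsqrt : Real.sqrt (ℓ / L') = t / 2560 := by
      rw [hℓ_def, mul_div_assoc, div_self hL'0, mul_one, hκ_def, Real.sqrt_sq (by positivity)]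
    rw [hratio, hsqrt] at hcut
    have hoccΦ' : ENNReal.ofReal ((1 - t / 8) * N) ≤
        ENNReal.ofReal (lam ^ 3) * occB + ENNReal.ofReal (320 * N * (t / 2560)) :=
      hoccΦ.trans hcut
    have hsub : ENNReal.ofReal ((1 - t / 8) * N - 320 * N * (t / 2560)) ≤
        ENNReal.ofReal (lam ^ 3) * occB := by
      rw [ENNReal.ofReal_sub _ (by positivity)]
      exact tsub_le_iff_right.mpr hoccΦ'
    have hreal : lam ^ 3 * ((1 - η) * N) ≤ (1 - t / 8) * N - 320 * N * (t / 2560) :=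
      condensedTrial_occupation_budget ht0.le ht1 htη hlam31 hlam3 (Nat.cast_nonneg N)
    have hfin : ENNReal.ofReal ((1 - η) * N) ≤ occB := by
      have h := (ENNReal.ofReal_le_ofReal hreal).trans hsub
      rw [ENNReal.ofReal_mul (by positivity)] at h
      exact (ENNReal.mul_le_mul_iff_right (ENNReal.ofReal_pos.mpr (by positivity)).ne'
        ENNReal.ofReal_ne_top).1 h
    -- identify the mode (`box =ᵐ cell`) and the state
    rw [TrialState.castLen_ψ, ← hLeq]
    have hae : boxConstantMode (L' + 2 * ℓ) =ᵐ[volume] constantMode (L' + 2 * ℓ) := by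
      unfold boxConstantMode constantMode
      exact indicator_ae_eq_of_ae_eq_set
        (Literature.MathematicalPhysics.QuantumManyBody.NeumannBox.box_ae_eq_cell _)
    rw [← occupation_congr_ae hae]
    exact hfin

end Summit.AtomisticToContinuum.BoseEinsteinCondensation.NudgedCondensationLine

end
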